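import Mathlib
import Literature.AlgebraicGeometry.Resolution.CompletedChainPointStep
import Literature.AlgebraicGeometry.Resolution.NonRationalStepSolvable
import Literature.AlgebraicGeometry.Resolution.TotalPreparation
import Literature.AlgebraicGeometry.Resolution.PolygonMinimality
import HarnessLib

/-!
# The non-rational point step of the transport down the completed chain (`τ = 1` endgame, brick R-3)

Topic: `Literature/AlgebraicGeometry/Resolution`. V. Cossart, U. Jannsen, S. Saito, LNM 2270 (2020),
Thm. 14.4 («`β_{x′} < β_x` when `k(x′) ≠ k(x)`»), Lemma 14.8, and the proof of Thm. 13.7 («by the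
completeness of `R₀` we can choose a totally prepared label»), Thm. 8.24 [cite: CossartJannsenSaito2020, Thm. 14.4];
V. Cossart, O. Piltant, J. Algebra 320 (2008), Lemma 4.5 (2) [cite: CossartPiltant2008, Lemma 4.5];
H. Matsumura, *Commutative Ring Theory*, §8 [cite: Matsumura1987, Thm. 8.11].

OURS (brick R-3 of the completed-chain descent, architecture OPTION R): ONE NON-RATIONAL POINT STEP of the
transport of the totally prepared adapted system `x = (ŷ, u, ŵ)` of `R̂` down a point step `φ : R → R'`
whose near point is NOT rational over `x` and is described, for every adapted label `(y, u, w)` of `R`,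
by the contract clause `hnonrat` (the data `t, P, y′` of `PointStepTrichotomy` (iii) with the residue
criterion and `k(x′) = k(x)(t̄)`): a totally prepared adapted system `x′` of `R̂′` with
`x′ 1 = ι′(φ u)`, non-empty polygon, a monic element, **`β(x′) < β(x)`**, and the precision clause for
the new third parameter `x′ 2 = P̂(t̂)`. Engine: the completed chart data (density + shear), the
prepared `β`-drop `exists_prepared_label_nonRationalStep` (B6-nr) in `R̂ → R̂′`, re-total-preparation
in the complete ring `R̂′` (`exists_preparedUpTo_forall_of_forall_not_le`, needs «no permissible formal
surface» `hNS'`) and the persistence of `(α, β)` under it (`alphaS_betaS_shiftZ_eq_of_vPrepared`).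
F-71 / T1 / N2 NOT proved; no summit statement is proved. AI-written; weaker than expert review.
-/

noncomputable section

open IsLocalRing MvPolynomial

namespace Literature.AlgebraicGeometry.Resolution

universe u

/-! ## Small tools -/

section Tools

variable {S : Type u} [CommRing S]

/-- `(a + s b, b, d + t b) = (a, b, d)` as ideals. [cite: Matsumura1987, Thm. 8.11] -/
theorem span_triple_shear_eq' (a b d s t : S) :
    Ideal.span ({a + s * b, b, d + t * b} : Set S) = Ideal.span {a, b, d} := by
  apply le_antisymm
  · rw [Ideal.span_le, Set.insert_subset_iff, Set.insert_subset_iff, Set.singleton_subset_iff]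
    refine ⟨?_, ?_, ?_⟩
    · exact Ideal.add_mem _ (Ideal.subset_span (by simp))
        (Ideal.mul_mem_left _ _ (Ideal.subset_span (by simp)))
    · exact Ideal.subset_span (by simp)
    · exact Ideal.add_mem _ (Ideal.subset_span (by simp))
        (Ideal.mul_mem_left _ _ (Ideal.subset_span (by simp)))
  · rw [Ideal.span_le, Set.insert_subset_iff, Set.insert_subset_iff, Set.singleton_subset_iff]
    have hb : b ∈ Ideal.span ({a + s * b, b, d + t * b} : Set S) := Ideal.subset_span (by simp)
    refine ⟨?_, hb, ?_⟩
    · have h1 : a + s * b ∈ Ideal.span ({a + s * b, b, d + t * b} : Set S) := Ideal.subset_span (by simp)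
      have h := Ideal.sub_mem _ h1 (Ideal.mul_mem_left _ s hb)
      rwa [add_sub_cancel_right] at h
    · have h1 : d + t * b ∈ Ideal.span ({a + s * b, b, d + t * b} : Set S) := Ideal.subset_span (by simp)
      have h := Ideal.sub_mem _ h1 (Ideal.mul_mem_left _ t hb)
      rwa [add_sub_cancel_right] at h

/-- `(a + t, b, d) = (a, b, d)` for `t ∈ (b, d)`. [cite: Matsumura1987, Thm. 8.11] -/
theorem span_triple_add_eq_of_mem (a b d t : S) (ht : t ∈ Ideal.span ({b, d} : Set S)) :
    Ideal.span ({a + t, b, d} : Set S) = Ideal.span {a, b, d} := by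
  have hmem : ∀ y : S, t ∈ Ideal.span ({y, b, d} : Set S) := by
    intro y
    rw [Ideal.span_insert]
    exact Ideal.mem_sup_right ht
  apply le_antisymm
  · rw [Ideal.span_le, Set.insert_subset_iff, Set.insert_subset_iff, Set.singleton_subset_iff]
    exact ⟨Ideal.add_mem _ (Ideal.subset_span (by simp)) (hmem a), Ideal.subset_span (by simp),
      Ideal.subset_span (by simp)⟩
  · rw [Ideal.span_le, Set.insert_subset_iff, Set.insert_subset_iff, Set.singleton_subset_iff]
    refine ⟨?_, Ideal.subset_span (by simp), Ideal.subset_span (by simp)⟩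
    have h1 : a + t ∈ Ideal.span ({a + t, b, d} : Set S) := Ideal.subset_span (by simp)
    have h := Ideal.sub_mem _ h1 (hmem (a + t))
    rwa [add_sub_cancel_right] at h

variable [IsRegularLocalRing S]

/-- A member of a regular system of parameters of a three-dimensional regular local ring is non-zero.
[cite: Matsumura1987, Thm. 14.2] -/
theorem ne_zero_of_span_triple' {a b d : S} (hdim : ringKrullDim S = 3)
    (h : Ideal.span ({a, b, d} : Set S) = maximalIdeal S) : b ≠ 0 := by
  intro hb
  have hfr : (maximalIdeal S).spanFinrank = 3 := by
    have h := IsRegularLocalRing.spanFinrank_maximalIdeal (R := S)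
    rw [hdim] at h
    exact_mod_cast h
  have heq : Ideal.span ({a, d} : Set S) = maximalIdeal S := by
    rw [← h, hb]
    apply le_antisymm
    · exact Ideal.span_mono (by intro x hx; rcases hx with rfl | rfl <;> simp)
    · rw [Ideal.span_le, Set.insert_subset_iff, Set.insert_subset_iff, Set.singleton_subset_iff]
      exact ⟨Ideal.subset_span (by simp), Ideal.zero_mem _, Ideal.subset_span (by simp)⟩
  have hfin : ({a, d} : Set S).Finite := Set.toFinite _
  have hcard : (Ideal.span ({a, d} : Set S)).spanFinrank ≤ ({a, d} : Set S).ncard :=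
    Submodule.spanFinrank_span_le_ncard_of_finite hfin
  have h2 : ({a, d} : Set S).ncard ≤ 2 := (Set.ncard_insert_le _ _).trans (by rw [Set.ncard_singleton])
  rw [heq, hfr] at hcard
  omega

end Tools

/-! ## The non-rational step -/

section NonRationalCompletedStep

variable {R R' : Type u} [CommRing R] [CommRing R'] [IsRegularLocalRing R] [IsRegularLocalRing R']
  (φ : R →+* R') [IsLocalHom φ] (hφm : (maximalIdeal R).map φ ≤ maximalIdeal R')
  (hdim : ringKrullDim R = 3) (hdim' : ringKrullDim R' = 3)

omit [IsLocalHom φ] in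
include hφm hdim hdim' in
/-- **R-3 (OURS). The non-rational point step of the transport down the completed chain.** See the module
docstring. [cite: CossartJannsenSaito2020, Thm. 14.4, Lemma 14.8, Thm. 8.24] [cite: CossartPiltant2008, Lemma 4.5 (2)]
[cite: Matsumura1987, Thm. 8.11] -/
theorem completedChain_nonRational_step
    {I : Ideal R} {I' : Ideal R'} {μ : ℕ} (u : R)
    (hIμ : I ≤ maximalIdeal R ^ μ) (hIne : ¬ I ≤ maximalIdeal R ^ (μ + 1))
    (hIμ' : I' ≤ maximalIdeal R' ^ μ) (hIne' : ¬ I' ≤ maximalIdeal R' ^ (μ + 1))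
    (hI : I' = (I.map φ).colon {φ u ^ μ})
    (hτ' : ∀ c' : Fin 3 → R', Ideal.span {c' 0, c' 1, c' 2} = maximalIdeal R' → hironakaTauAt c' I' μ = 1)
    (hnonrat : ∀ (y w : R), Ideal.span {y, u, w} = maximalIdeal R →
      (∀ G ∈ initialForms ![y, u, w] I μ, ∃ a : ResidueField R, G = C a * X 0 ^ μ) →
      ∃ (t : R') (Q : Polynomial R) (y' : R'),
        φ y = φ u * y' ∧ φ w = φ u * t ∧ Q.Monic ∧
        2 ≤ (Q.map (residue R)).natDegree ∧ Irreducible (Q.map (residue R)) ∧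
        (∀ G : Polynomial R, Polynomial.eval₂ φ t G ∈ maximalIdeal R' ↔
          Q.map (residue R) ∣ G.map (residue R)) ∧
        (∀ r : ResidueField R', ∃ G : Polynomial R, residue R' (Polynomial.eval₂ φ t G) = r) ∧
        Ideal.span {y', φ u, Polynomial.eval₂ φ t Q} = maximalIdeal R')
    [IsRegularLocalRing (AdicCompletion (maximalIdeal R) R)] [IsRegularLocalRing (AdicCompletion (maximalIdeal R') R')]
    (x : Fin 3 → (AdicCompletion (maximalIdeal R) R)) (hx1 : x 1 = (algebraMap R (AdicCompletion (maximalIdeal R) R)) u)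
    (hgenx : Ideal.span {x 0, x 1, x 2} = maximalIdeal (AdicCompletion (maximalIdeal R) R))
    (hprep : ∀ B, PreparedUpTo x (I.map (algebraMap R (AdicCompletion (maximalIdeal R) R))) μ B)
    (hne : (pts x (I.map (algebraMap R (AdicCompletion (maximalIdeal R) R))) μ).Nonempty)
    (hδ : μ.factorial < deltaS x (I.map (algebraMap R (AdicCompletion (maximalIdeal R) R))) μ)
    (hα : alphaS x (I.map (algebraMap R (AdicCompletion (maximalIdeal R) R))) μ < μ.factorial)
    (hNS' : ∀ c' : Fin 3 → (AdicCompletion (maximalIdeal R') R'),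
      Ideal.span {c' 0, c' 1, c' 2} = maximalIdeal (AdicCompletion (maximalIdeal R') R') →
      ¬ I'.map (algebraMap R' (AdicCompletion (maximalIdeal R') R')) ≤ Ideal.span {c' 0 ^ μ})
    (w : R) (hw : x 2 - (algebraMap R (AdicCompletion (maximalIdeal R) R)) w ∈ maximalIdeal (AdicCompletion (maximalIdeal R) R) ^ 2) :
    ∃ (x' : Fin 3 → (AdicCompletion (maximalIdeal R') R')) (Q : Polynomial R'),
      x' 1 = (algebraMap R' (AdicCompletion (maximalIdeal R') R')) (φ u) ∧
      Ideal.span {x' 0, x' 1, x' 2} = maximalIdeal (AdicCompletion (maximalIdeal R') R') ∧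
      (∀ B, PreparedUpTo x' (I'.map (algebraMap R' (AdicCompletion (maximalIdeal R') R'))) μ B) ∧
      (pts x' (I'.map (algebraMap R' (AdicCompletion (maximalIdeal R') R'))) μ).Nonempty ∧
      μ.factorial < deltaS x' (I'.map (algebraMap R' (AdicCompletion (maximalIdeal R') R'))) μ ∧
      HasMonic x' (I'.map (algebraMap R' (AdicCompletion (maximalIdeal R') R'))) μ ∧
      betaS x' (I'.map (algebraMap R' (AdicCompletion (maximalIdeal R') R'))) μ <
        betaS x (I.map (algebraMap R (AdicCompletion (maximalIdeal R) R))) μ ∧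
      (∀ (w₁ : R) (w₁' : R') (k : ℕ), φ w₁ = φ u * w₁' →
        x 2 - (algebraMap R (AdicCompletion (maximalIdeal R) R)) w₁ ∈ maximalIdeal (AdicCompletion (maximalIdeal R) R) ^ (k + 1) →
        x' 2 - (algebraMap R' (AdicCompletion (maximalIdeal R') R')) (Polynomial.eval w₁' Q) ∈
          maximalIdeal (AdicCompletion (maximalIdeal R') R') ^ k) := by
  classical
  have hL := Nat.factorial_pos μ
  have hdimA : ringKrullDim (AdicCompletion (maximalIdeal R) R) = 3 := by rw [ringKrullDim_adicCompletion, hdim]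
  have hdimB : ringKrullDim (AdicCompletion (maximalIdeal R') R') = 3 := by rw [ringKrullDim_adicCompletion, hdim']
  have hfrA : (maximalIdeal (AdicCompletion (maximalIdeal R) R)).spanFinrank = 3 := by
    have h := IsRegularLocalRing.spanFinrank_maximalIdeal (R := (AdicCompletion (maximalIdeal R) R))
    rw [hdimA] at h
    exact_mod_cast h
  have hfrB : (maximalIdeal (AdicCompletion (maximalIdeal R') R')).spanFinrank = 3 := by
    have h := IsRegularLocalRing.spanFinrank_maximalIdeal (R := (AdicCompletion (maximalIdeal R') R'))
    rw [hdimB] at h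
    exact_mod_cast h
  haveI hφHloc : IsLocalHom (adicCompletionMap (maximalIdeal R) (maximalIdeal R') φ hφm) := isLocalHom_adicCompletionMap' φ hφm
  haveI : IsDomain R' := isDomain_of_isRegularLocalRing R'
  haveI : IsDomain (AdicCompletion (maximalIdeal R') R') := isDomain_of_isRegularLocalRing _
  have hmA : maximalIdeal (AdicCompletion (maximalIdeal R) R) = (maximalIdeal R).map (algebraMap R (AdicCompletion (maximalIdeal R) R)) := AdicCompletion.maximalIdeal_eq_map
  have hmB : maximalIdeal (AdicCompletion (maximalIdeal R') R') = (maximalIdeal R').map (algebraMap R' (AdicCompletion (maximalIdeal R') R')) := AdicCompletion.maximalIdeal_eq_map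
  have hIμA : (I.map (algebraMap R (AdicCompletion (maximalIdeal R) R))) ≤ maximalIdeal (AdicCompletion (maximalIdeal R) R) ^ μ := map_le_pow_maximalIdeal_adicCompletion hIμ
  have hIneA : ¬ (I.map (algebraMap R (AdicCompletion (maximalIdeal R) R))) ≤ maximalIdeal (AdicCompletion (maximalIdeal R) R) ^ (μ + 1) := not_map_le_pow_maximalIdeal_adicCompletion hIne
  have hIμB : (I'.map (algebraMap R' (AdicCompletion (maximalIdeal R') R'))) ≤ maximalIdeal (AdicCompletion (maximalIdeal R') R') ^ μ := map_le_pow_maximalIdeal_adicCompletion hIμ'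
  have hIneB : ¬ (I'.map (algebraMap R' (AdicCompletion (maximalIdeal R') R'))) ≤ maximalIdeal (AdicCompletion (maximalIdeal R') R') ^ (μ + 1) := not_map_le_pow_maximalIdeal_adicCompletion hIne'
  have hgenxr := span_range_eq_of_span_triple x hgenx
  -- (A) an `R`-approximation `l` of `ŷ`; the label `(l, u, w)` of `R`
  obtain ⟨l, hl⟩ := exists_sub_algebraMap_mem_pow_adicCompletion (x 0) 2
  set cR : Fin 3 → R := ![l, u, w] with hcR
  have hdiff : ∀ i, (algebraMap R (AdicCompletion (maximalIdeal R) R)) (cR i) - x i ∈ maximalIdeal (AdicCompletion (maximalIdeal R) R) ^ 2 := by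
    intro i
    fin_cases i
    · show (algebraMap R (AdicCompletion (maximalIdeal R) R)) l - x 0 ∈ _
      rw [← neg_sub, Ideal.neg_mem_iff]; exact hl
    · show (algebraMap R (AdicCompletion (maximalIdeal R) R)) u - x 1 ∈ _
      rw [hx1, sub_self]; exact Ideal.zero_mem _
    · show (algebraMap R (AdicCompletion (maximalIdeal R) R)) w - x 2 ∈ _
      rw [← neg_sub, Ideal.neg_mem_iff]; exact hw
  have hgenιr : Ideal.span (Set.range (fun i => (algebraMap R (AdicCompletion (maximalIdeal R) R)) (cR i))) = maximalIdeal (AdicCompletion (maximalIdeal R) R) :=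
    span_range_eq_of_sub_mem_sq hgenxr hdiff
  have hgenι : Ideal.span {(algebraMap R (AdicCompletion (maximalIdeal R) R)) (cR 0), (algebraMap R (AdicCompletion (maximalIdeal R) R)) (cR 1), (algebraMap R (AdicCompletion (maximalIdeal R) R)) (cR 2)} = maximalIdeal (AdicCompletion (maximalIdeal R) R) := by
    rw [← hgenιr]; congr 1; ext z
    simp only [Set.mem_insert_iff, Set.mem_singleton_iff, Set.mem_range]
    constructor
    · rintro (rfl | rfl | rfl)
      exacts [⟨0, rfl⟩, ⟨1, rfl⟩, ⟨2, rfl⟩]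
    · rintro ⟨i, rfl⟩; fin_cases i <;> simp
  haveI : Module.FaithfullyFlat R (AdicCompletion (maximalIdeal R) R) := Module.FaithfullyFlat.of_flat_of_isLocalHom
  have hgenR : Ideal.span {cR 0, cR 1, cR 2} = maximalIdeal R := by
    have h1 : (Ideal.span ({cR 0, cR 1, cR 2} : Set R)).map (algebraMap R (AdicCompletion (maximalIdeal R) R)) = (maximalIdeal R).map (algebraMap R (AdicCompletion (maximalIdeal R) R)) := by
      rw [Ideal.map_span, Set.image_insert_eq, Set.image_insert_eq, Set.image_singleton, hgenι, hmA]
    have h2 := congrArg (Ideal.comap (algebraMap R (AdicCompletion (maximalIdeal R) R))) h1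
    rwa [Ideal.comap_map_eq_self_of_faithfullyFlat, Ideal.comap_map_eq_self_of_faithfullyFlat] at h2
  -- (B) the label is adapted
  have hadx := forall_initialForms_of_lt_deltaS x hgenx hdimA hIμA hδ
  have hformsι : ∀ G ∈ initialForms (fun i => (algebraMap R (AdicCompletion (maximalIdeal R) R)) (cR i)) (I.map (algebraMap R (AdicCompletion (maximalIdeal R) R))) μ, ∃ a : ResidueField (AdicCompletion (maximalIdeal R) R), G = C a * X 0 ^ μ := by
    intro G hG
    rw [initialForms_eq_of_sub_mem_sq hfrA hgenxr hdiff] at hG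
    exact hadx G hG
  have hadR : ∀ G ∈ initialForms cR I μ, ∃ a : ResidueField R, G = C a * X 0 ^ μ := by
    intro G hG
    have hbij := AdicCompletion.residueField_map_bijective R
    have hmem : MvPolynomial.map (ResidueField.map (algebraMap R (AdicCompletion (maximalIdeal R) R))) G ∈ initialForms (fun i => (algebraMap R (AdicCompletion (maximalIdeal R) R)) (cR i)) (I.map (algebraMap R (AdicCompletion (maximalIdeal R) R))) μ :=
      (mem_initialForms_map_adicCompletion_iff cR hgenR hdim hIμ _).mpr ⟨G, hG, rfl⟩
    obtain ⟨a, ha⟩ := hformsι _ hmem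
    obtain ⟨a₀, rfl⟩ := hbij.2 a
    refine ⟨a₀, MvPolynomial.map_injective _ hbij.1 ?_⟩
    rw [ha, map_mul, map_C, map_pow, map_X]
  -- (C) the contract's non-rational chart data on the label
  obtain ⟨t, P, l', hl', hwt, hPmonic, hd, -, hres, hκ, hgen'⟩ := hnonrat l w hgenR hadR
  have hu0 : φ u ≠ 0 := ne_zero_of_span_triple' hdim' hgen'
  -- the `u`-chart: `𝔪 R' = (φ u)`
  have hmapφ : (maximalIdeal R).map φ = Ideal.span {φ u} := by
    apply le_antisymm
    · rw [← hgenR, Ideal.map_span, Ideal.span_le]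
      rintro _ ⟨z, hz, rfl⟩
      rcases hz with rfl | rfl | rfl
      · exact Ideal.mem_span_singleton'.mpr ⟨l', by simp [hl', mul_comm]⟩
      · exact Ideal.subset_span (by simp)
      · exact Ideal.mem_span_singleton'.mpr ⟨t, by simp [hwt, mul_comm]⟩
    · rw [Ideal.span_singleton_le_iff_mem]
      exact Ideal.mem_map_of_mem _ (hgenR ▸ Ideal.subset_span (Or.inr (Or.inl rfl)))
  -- (D) the completed chart
  have hmapH := map_maximalIdeal_adicCompletionMap_eq_span φ hφm hmapφ
  have hû : (adicCompletionMap (maximalIdeal R) (maximalIdeal R') φ hφm) (x 1) = (algebraMap R' (AdicCompletion (maximalIdeal R') R')) (φ u) := by rw [hx1, adicCompletionMap_algebraMap]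
  rw [adicCompletionMap_algebraMap] at hmapH
  have hsq : ∀ z : (AdicCompletion (maximalIdeal R) R), z ∈ maximalIdeal (AdicCompletion (maximalIdeal R) R) ^ 2 → ∃ s : (AdicCompletion (maximalIdeal R') R'), (adicCompletionMap (maximalIdeal R) (maximalIdeal R') φ hφm) z = (algebraMap R' (AdicCompletion (maximalIdeal R') R')) (φ u) ^ 2 * s := by
    intro z hz
    have h1 : (adicCompletionMap (maximalIdeal R) (maximalIdeal R') φ hφm) z ∈ (maximalIdeal (AdicCompletion (maximalIdeal R) R) ^ 2).map (adicCompletionMap (maximalIdeal R) (maximalIdeal R') φ hφm) := Ideal.mem_map_of_mem _ hz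
    rw [Ideal.map_pow, hmapH, Ideal.span_singleton_pow] at h1
    obtain ⟨s, hs⟩ := Ideal.mem_span_singleton'.mp h1
    exact ⟨s, by rw [← hs, mul_comm]⟩
  obtain ⟨s₀, hs₀⟩ := hsq _ hl
  obtain ⟨s₂, hs₂⟩ := hsq _ hw
  -- the transported data: `c′ = (ŷ′, û, P̂(t̂))`, `t̂ = ι′ t + û s₂`, `P̂ = P.map ι`
  set th : (AdicCompletion (maximalIdeal R') R') := (algebraMap R' (AdicCompletion (maximalIdeal R') R')) t + (algebraMap R' (AdicCompletion (maximalIdeal R') R')) (φ u) * s₂ with hth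
  set Ph : Polynomial (AdicCompletion (maximalIdeal R) R) := Polynomial.map (algebraMap R (AdicCompletion (maximalIdeal R) R)) P with hPh
  set c' : Fin 3 → (AdicCompletion (maximalIdeal R') R') := ![(algebraMap R' (AdicCompletion (maximalIdeal R') R')) l' + s₀ * (algebraMap R' (AdicCompletion (maximalIdeal R') R')) (φ u), (algebraMap R' (AdicCompletion (maximalIdeal R') R')) (φ u), Polynomial.eval₂ (adicCompletionMap (maximalIdeal R) (maximalIdeal R') φ hφm) th Ph] with hc'
  have hc'0 : c' 0 = (algebraMap R' (AdicCompletion (maximalIdeal R') R')) l' + s₀ * (algebraMap R' (AdicCompletion (maximalIdeal R') R')) (φ u) := rfl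
  have hc'1 : c' 1 = (algebraMap R' (AdicCompletion (maximalIdeal R') R')) (φ u) := rfl
  have hc'2 : c' 2 = Polynomial.eval₂ (adicCompletionMap (maximalIdeal R) (maximalIdeal R') φ hφm) th Ph := rfl
  have h₁ : c' 1 = (adicCompletionMap (maximalIdeal R) (maximalIdeal R') φ hφm) (x 1) := by rw [hû, hc'1]
  have h₀ : (adicCompletionMap (maximalIdeal R) (maximalIdeal R') φ hφm) (x 0) = (adicCompletionMap (maximalIdeal R) (maximalIdeal R') φ hφm) (x 1) * c' 0 := by
    have : x 0 = (algebraMap R (AdicCompletion (maximalIdeal R) R)) l + (x 0 - (algebraMap R (AdicCompletion (maximalIdeal R) R)) l) := by ring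
    rw [hû, hc'0, this, map_add, hs₀, adicCompletionMap_algebraMap, hl', map_mul]; ring
  have ht : (adicCompletionMap (maximalIdeal R) (maximalIdeal R') φ hφm) (x 2) = (adicCompletionMap (maximalIdeal R) (maximalIdeal R') φ hφm) (x 1) * th := by
    have : x 2 = (algebraMap R (AdicCompletion (maximalIdeal R) R)) w + (x 2 - (algebraMap R (AdicCompletion (maximalIdeal R) R)) w) := by ring
    rw [hû, hth, this, map_add, hs₂, adicCompletionMap_algebraMap, hwt, map_mul]; ring
  -- evaluation of `R`-polynomials along the completed chart
  have hcomp : (adicCompletionMap (maximalIdeal R) (maximalIdeal R') φ hφm).comp (algebraMap R (AdicCompletion (maximalIdeal R) R)) = (algebraMap R' (AdicCompletion (maximalIdeal R') R')).comp φ := adicCompletionMap_comp_algebraMap' φ hφm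
  have heval : ∀ G : Polynomial R, ∃ q : (AdicCompletion (maximalIdeal R') R'),
      Polynomial.eval₂ (adicCompletionMap (maximalIdeal R) (maximalIdeal R') φ hφm) th (Polynomial.map (algebraMap R (AdicCompletion (maximalIdeal R) R)) G) = (algebraMap R' (AdicCompletion (maximalIdeal R') R')) (Polynomial.eval₂ φ t G) + (algebraMap R' (AdicCompletion (maximalIdeal R') R')) (φ u) * q := by
    intro G
    have h1 : Polynomial.eval₂ (adicCompletionMap (maximalIdeal R) (maximalIdeal R') φ hφm) th (Polynomial.map (algebraMap R (AdicCompletion (maximalIdeal R) R)) G) = Polynomial.eval th (Polynomial.map ((algebraMap R' (AdicCompletion (maximalIdeal R') R')).comp φ) G) := by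
      rw [Polynomial.eval₂_map, hcomp, Polynomial.eval_map]
    have h2 : Polynomial.eval ((algebraMap R' (AdicCompletion (maximalIdeal R') R')) t) (Polynomial.map ((algebraMap R' (AdicCompletion (maximalIdeal R') R')).comp φ) G) = (algebraMap R' (AdicCompletion (maximalIdeal R') R')) (Polynomial.eval₂ φ t G) := by
      rw [← Polynomial.map_map, Polynomial.eval_map, Polynomial.eval₂_map, Polynomial.hom_eval₂]
    obtain ⟨q, hq⟩ := Polynomial.sub_dvd_eval_sub th ((algebraMap R' (AdicCompletion (maximalIdeal R') R')) t) (Polynomial.map ((algebraMap R' (AdicCompletion (maximalIdeal R') R')).comp φ) G)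
    refine ⟨s₂ * q, ?_⟩
    rw [h1, ← h2]
    have : th - (algebraMap R' (AdicCompletion (maximalIdeal R') R')) t = (algebraMap R' (AdicCompletion (maximalIdeal R') R')) (φ u) * s₂ := by rw [hth]; ring
    rw [this] at hq
    linear_combination hq
  obtain ⟨q₂, hq₂⟩ := heval P
  have hc'2' : c' 2 = (algebraMap R' (AdicCompletion (maximalIdeal R') R')) (Polynomial.eval₂ φ t P) + q₂ * (algebraMap R' (AdicCompletion (maximalIdeal R') R')) (φ u) := by rw [hc'2, hPh, hq₂]; ring
  have hgenB' : Ideal.span {c' 0, c' 1, c' 2} = maximalIdeal (AdicCompletion (maximalIdeal R') R') := by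
    rw [hc'0, hc'1, hc'2', span_triple_shear_eq', hmB, ← hgen', Ideal.map_span, Set.image_insert_eq,
      Set.image_insert_eq, Set.image_singleton]
  have hgenB'r := span_range_eq_of_span_triple c' hgenB'
  have hûm : (algebraMap R' (AdicCompletion (maximalIdeal R') R')) (φ u) ∈ maximalIdeal (AdicCompletion (maximalIdeal R') R') := by rw [← hc'1, ← hgenB']; exact Ideal.subset_span (by simp)
  -- residue fields: `k(R) ≅ k(R̂)`, `k(R') ≅ k(R̂')`
  have hbijA := AdicCompletion.residueField_map_bijective R
  have hbijB := AdicCompletion.residueField_map_bijective R'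
  set ρ : R →+* ResidueField (AdicCompletion (maximalIdeal R) R) := (residue (AdicCompletion (maximalIdeal R) R)).comp (algebraMap R (AdicCompletion (maximalIdeal R) R)) with hρ
  have hρ' : ρ = (ResidueField.map (algebraMap R (AdicCompletion (maximalIdeal R) R))).comp (residue R) := by
    refine RingHom.ext fun r => ?_
    simp only [hρ, RingHom.comp_apply, ResidueField.map_residue]
  have hρsurj : Function.Surjective ρ := by
    rw [hρ']; exact hbijA.2.comp residue_surjective
  have hmapA : (maximalIdeal (AdicCompletion (maximalIdeal R) R)).map (adicCompletionMap (maximalIdeal R) (maximalIdeal R') φ hφm) ≤ maximalIdeal (AdicCompletion (maximalIdeal R') R') := ((IsLocalRing.local_hom_TFAE (adicCompletionMap (maximalIdeal R) (maximalIdeal R') φ hφm)).out 0 2).mp hφHloc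
  have hmemB : ∀ z : R', (algebraMap R' (AdicCompletion (maximalIdeal R') R')) z ∈ maximalIdeal (AdicCompletion (maximalIdeal R') R') ↔ z ∈ maximalIdeal R' := by
    intro z
    rw [mem_maximalIdeal, mem_maximalIdeal, mem_nonunits_iff, mem_nonunits_iff, isUnit_map_iff]
  -- the residue criterion in the completions
  have hPbar : Polynomial.map (residue (AdicCompletion (maximalIdeal R) R)) Ph = Polynomial.map (ResidueField.map (algebraMap R (AdicCompletion (maximalIdeal R) R))) (Polynomial.map (residue R) P) := by
    rw [hPh, Polynomial.map_map, Polynomial.map_map, ← hρ', hρ]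
  have hresH : ∀ G : Polynomial (AdicCompletion (maximalIdeal R) R), Polynomial.eval₂ (adicCompletionMap (maximalIdeal R) (maximalIdeal R') φ hφm) th G ∈ maximalIdeal (AdicCompletion (maximalIdeal R') R') ↔
      Polynomial.map (residue (AdicCompletion (maximalIdeal R) R)) Ph ∣ Polynomial.map (residue (AdicCompletion (maximalIdeal R) R)) G := by
    intro G
    obtain ⟨G₀, hG₀⟩ := Polynomial.map_surjective ρ hρsurj (Polynomial.map (residue (AdicCompletion (maximalIdeal R) R)) G)
    have hGbar : Polynomial.map (residue (AdicCompletion (maximalIdeal R) R)) G = Polynomial.map (ResidueField.map (algebraMap R (AdicCompletion (maximalIdeal R) R))) (Polynomial.map (residue R) G₀) := by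
      rw [← hG₀, Polynomial.map_map, ← hρ']
    -- `G ≡ G₀.map ι` coefficientwise modulo `𝔪̂`
    have hdiffc : ∀ n, (G - Polynomial.map (algebraMap R (AdicCompletion (maximalIdeal R) R)) G₀).coeff n ∈ maximalIdeal (AdicCompletion (maximalIdeal R) R) := by
      rw [← polynomial_map_residue_eq_zero_iff, Polynomial.map_sub, Polynomial.map_map, ← hρ, hG₀, sub_self]
    have hdiffm : Polynomial.eval₂ (adicCompletionMap (maximalIdeal R) (maximalIdeal R') φ hφm) th (G - Polynomial.map (algebraMap R (AdicCompletion (maximalIdeal R) R)) G₀) ∈ maximalIdeal (AdicCompletion (maximalIdeal R') R') :=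
      hmapA (eval₂_mem_map_of_forall_coeff_mem (adicCompletionMap (maximalIdeal R) (maximalIdeal R') φ hφm) hdiffc th)
    obtain ⟨q, hq⟩ := heval G₀
    have hstep : Polynomial.eval₂ (adicCompletionMap (maximalIdeal R) (maximalIdeal R') φ hφm) th G ∈ maximalIdeal (AdicCompletion (maximalIdeal R') R') ↔ Polynomial.eval₂ φ t G₀ ∈ maximalIdeal R' := by
      have heq : Polynomial.eval₂ (adicCompletionMap (maximalIdeal R) (maximalIdeal R') φ hφm) th G = Polynomial.eval₂ (adicCompletionMap (maximalIdeal R) (maximalIdeal R') φ hφm) th (G - Polynomial.map (algebraMap R (AdicCompletion (maximalIdeal R) R)) G₀) +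
          ((algebraMap R' (AdicCompletion (maximalIdeal R') R')) (Polynomial.eval₂ φ t G₀) + (algebraMap R' (AdicCompletion (maximalIdeal R') R')) (φ u) * q) := by
        rw [← hq, Polynomial.eval₂_sub]; ring
      rw [heq, ← hmemB]
      constructor
      · intro h
        have h1 := Ideal.sub_mem _ (Ideal.sub_mem _ h hdiffm) (Ideal.mul_mem_right q _ hûm)
        have : Polynomial.eval₂ (adicCompletionMap (maximalIdeal R) (maximalIdeal R') φ hφm) th (G - Polynomial.map (algebraMap R (AdicCompletion (maximalIdeal R) R)) G₀) + ((algebraMap R' (AdicCompletion (maximalIdeal R') R')) (Polynomial.eval₂ φ t G₀) + (algebraMap R' (AdicCompletion (maximalIdeal R') R')) (φ u) * q) -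
            Polynomial.eval₂ (adicCompletionMap (maximalIdeal R) (maximalIdeal R') φ hφm) th (G - Polynomial.map (algebraMap R (AdicCompletion (maximalIdeal R) R)) G₀) - (algebraMap R' (AdicCompletion (maximalIdeal R') R')) (φ u) * q = (algebraMap R' (AdicCompletion (maximalIdeal R') R')) (Polynomial.eval₂ φ t G₀) := by ring
        rwa [this] at h1
      · intro h
        exact Ideal.add_mem _ hdiffm (Ideal.add_mem _ h (Ideal.mul_mem_right q _ hûm))
    rw [hstep, hres G₀, hPbar, hGbar]
    exact (Polynomial.map_dvd_map (ResidueField.map (algebraMap R (AdicCompletion (maximalIdeal R) R))) hbijA.1 (hPmonic.map (residue R))).symm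
  -- `k(R̂')` is generated by `t̄`
  have hκH : ∀ r : ResidueField (AdicCompletion (maximalIdeal R') R'), ∃ G : Polynomial (AdicCompletion (maximalIdeal R) R), residue (AdicCompletion (maximalIdeal R') R') (Polynomial.eval₂ (adicCompletionMap (maximalIdeal R) (maximalIdeal R') φ hφm) th G) = r := by
    intro r
    obtain ⟨r₀, rfl⟩ := hbijB.2 r
    obtain ⟨G₀, hG₀⟩ := hκ r₀
    obtain ⟨q, hq⟩ := heval G₀
    refine ⟨Polynomial.map (algebraMap R (AdicCompletion (maximalIdeal R) R)) G₀, ?_⟩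
    rw [hq, map_add, ← hG₀, ResidueField.map_residue, add_eq_left, residue_eq_zero_iff]
    exact Ideal.mul_mem_right q _ hûm
  have hdH : 2 ≤ (Polynomial.map (residue (AdicCompletion (maximalIdeal R) R)) Ph).natDegree := by
    rw [hPbar, Polynomial.natDegree_map_eq_of_injective hbijA.1]; exact hd
  -- the weak transform in the completed chain
  have hJ' : (I'.map (algebraMap R' (AdicCompletion (maximalIdeal R') R'))) = ((I.map (algebraMap R (AdicCompletion (maximalIdeal R) R))).map (adicCompletionMap (maximalIdeal R) (maximalIdeal R') φ hφm)).colon {(adicCompletionMap (maximalIdeal R) (maximalIdeal R') φ hφm) (x 1) ^ μ} := by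
    rw [hx1]; exact weakTransform_adicCompletion_of_eq φ hφm hI
  -- `w⁻`-preparedness of `x`, a witness of order `μ`
  have hwprep : WMinusPrepared x (I.map (algebraMap R (AdicCompletion (maximalIdeal R) R))) μ := wMinusPrepared_of_preparedUpTo x hgenx hdimA hIμA hne le_rfl (hprep _)
  have hord : ∃ g ∈ (I.map (algebraMap R (AdicCompletion (maximalIdeal R) R))), g ∉ maximalIdeal (AdicCompletion (maximalIdeal R) R) ^ (μ + 1) := by
    obtain ⟨g, hgJ, hg⟩ := SetLike.not_le_iff_exists.mp hIneA
    exact ⟨g, hgJ, hg⟩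
  -- `τ = 1` for `c′` (from the `R'`-label `(l', φ u, P(t))`, completion invariance and rsop invariance)
  have hτc' : hironakaTauAt c' (I'.map (algebraMap R' (AdicCompletion (maximalIdeal R') R'))) μ = 1 := by
    set cB : Fin 3 → R' := ![l', φ u, Polynomial.eval₂ φ t P] with hcB
    have hgcB : Ideal.span {cB 0, cB 1, cB 2} = maximalIdeal R' := hgen'
    have h1 := hironakaTauAt_map_adicCompletion cB hgcB hdim' hIμ'
    rw [hτ' cB hgcB] at h1
    have hgcBι : Ideal.span (Set.range (fun i => (algebraMap R' (AdicCompletion (maximalIdeal R') R')) (cB i))) = maximalIdeal (AdicCompletion (maximalIdeal R') R') :=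
      span_range_algebraMap_adicCompletion_eq_maximalIdeal (span_range_eq_of_span_triple cB hgcB)
    rw [← h1]
    exact hironakaTauAt_eq_of_rsop hfrB hgcBι hgenB'r _ μ
  -- (E) B6-nr: the prepared `β`-drop at the non-rational point, in `R̂ → R̂'`
  obtain ⟨cs, hcs1, hcs2, -, hgens, hnes, hδs, hvps, hwps, -, -, hβs⟩ :=
    exists_prepared_label_nonRationalStep (adicCompletionMap (maximalIdeal R) (maximalIdeal R') φ hφm) h₁ h₀ ht hc'2 hgenx hdimA hgenB' hdimB hresH hJ' hdH hκH hIμA hord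
      hne hδ hα hwprep hIμB hτc'
  have hmons : HasMonic cs (I'.map (algebraMap R' (AdicCompletion (maximalIdeal R') R'))) μ := hasMonic_of_lt_deltaS cs hgens hdimB hIμB hIneB hδs
  -- (F) re-total-preparation in the complete ring `R̂'`
  have hhyp : ∀ s ∈ Ideal.span ({cs 1, cs 2} : Set (AdicCompletion (maximalIdeal R') R')), ¬ (I'.map (algebraMap R' (AdicCompletion (maximalIdeal R') R'))) ≤ Ideal.span {(cs 0 + s) ^ μ} := by
    intro s hs hle
    have hg : Ideal.span {(![cs 0 + s, cs 1, cs 2] : Fin 3 → (AdicCompletion (maximalIdeal R') R')) 0, (![cs 0 + s, cs 1, cs 2] : Fin 3 → (AdicCompletion (maximalIdeal R') R')) 1,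
        (![cs 0 + s, cs 1, cs 2] : Fin 3 → (AdicCompletion (maximalIdeal R') R')) 2} = maximalIdeal (AdicCompletion (maximalIdeal R') R') := by
      simp only [Matrix.cons_val_zero, Matrix.cons_val_one, Matrix.cons_val_two, Matrix.head_cons, Matrix.tail_cons]
      rw [span_triple_add_eq_of_mem _ _ _ _ hs]; exact hgens
    exact hNS' _ hg (by simpa using hle)
  obtain ⟨ct, hct1, hct2, -, hspan, hgent, hsub, hnet, hδt, hprept⟩ :=
    exists_preparedUpTo_forall_of_forall_not_le hdimB cs hgens hhyp hδs
  -- (α, β) persist under the re-preparation (Hironaka's vertex `v` of a `v`-prepared label)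
  have hshift : ct = shiftZ cs (ct 0 - cs 0) := by
    funext i; fin_cases i
    · simp [shiftZ]
    · simpa [shiftZ] using hct1
    · simpa [shiftZ] using hct2
  have hβt : betaS ct (I'.map (algebraMap R' (AdicCompletion (maximalIdeal R') R'))) μ = betaS cs (I'.map (algebraMap R' (AdicCompletion (maximalIdeal R') R'))) μ := by
    have hsub' : ∀ (w₀ q₁ q₂ : ℕ), 0 < w₀ → 0 < q₁ → 0 < q₂ →
        (∀ e ∈ pts cs (I'.map (algebraMap R' (AdicCompletion (maximalIdeal R') R'))) μ, w₀ ≤ q₁ * spt₁ μ e + q₂ * spt₂ μ e) →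
        ∀ e ∈ pts (shiftZ cs (ct 0 - cs 0)) (I'.map (algebraMap R' (AdicCompletion (maximalIdeal R') R'))) μ, w₀ ≤ q₁ * spt₁ μ e + q₂ * spt₂ μ e := by
      rw [← hshift]; exact hsub
    have := (alphaS_betaS_shiftZ_eq_of_vPrepared cs hgens hdimB hIμB hmons hnes hvps hspan hsub').2
    rwa [← hshift] at this
  have hmont : HasMonic ct (I'.map (algebraMap R' (AdicCompletion (maximalIdeal R') R'))) μ := hasMonic_of_lt_deltaS ct hgent hdimB hIμB hIneB (lt_of_lt_of_le hδs hδt)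
  refine ⟨ct, Polynomial.map φ P, hct1.trans (hcs1.trans hc'1), hgent, hprept, hnet, lt_of_lt_of_le hδs hδt, hmont,
    by rw [hβt]; exact hβs, fun w₁ w₁' k hw₁ hk => ?_⟩
  -- (G) the precision of the new third parameter `x' 2 = P̂(t̂)`
  have hûne : (algebraMap R' (AdicCompletion (maximalIdeal R') R')) (φ u) ≠ 0 := ne_zero_of_span_triple' hdimB hgenB'
  have h1 : (adicCompletionMap (maximalIdeal R) (maximalIdeal R') φ hφm) (x 2 - (algebraMap R (AdicCompletion (maximalIdeal R) R)) w₁) ∈ (maximalIdeal (AdicCompletion (maximalIdeal R) R) ^ (k + 1)).map (adicCompletionMap (maximalIdeal R) (maximalIdeal R') φ hφm) := Ideal.mem_map_of_mem _ hk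
  rw [Ideal.map_pow, hmapH, Ideal.span_singleton_pow] at h1
  obtain ⟨r, hr⟩ := Ideal.mem_span_singleton'.mp h1
  have h3 : (algebraMap R' (AdicCompletion (maximalIdeal R') R')) (φ u) * (th - (algebraMap R' (AdicCompletion (maximalIdeal R') R')) w₁' - (algebraMap R' (AdicCompletion (maximalIdeal R') R')) (φ u) ^ k * r) = 0 := by
    have e1 : (adicCompletionMap (maximalIdeal R) (maximalIdeal R') φ hφm) (x 2) = (algebraMap R' (AdicCompletion (maximalIdeal R') R')) (φ u) * th := by rw [← hû]; exact ht
    have e2 : (adicCompletionMap (maximalIdeal R) (maximalIdeal R') φ hφm) ((algebraMap R (AdicCompletion (maximalIdeal R) R)) w₁) = (algebraMap R' (AdicCompletion (maximalIdeal R') R')) (φ u) * (algebraMap R' (AdicCompletion (maximalIdeal R') R')) w₁' := by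
      rw [adicCompletionMap_algebraMap, hw₁, map_mul]
    rw [map_sub, e1, e2] at hr
    rw [mul_sub, mul_sub, ← hr]; ring
  have hth' : th - (algebraMap R' (AdicCompletion (maximalIdeal R') R')) w₁' ∈ maximalIdeal (AdicCompletion (maximalIdeal R') R') ^ k := by
    rcases mul_eq_zero.mp h3 with h | h
    · exact absurd h hûne
    · rw [sub_eq_zero.mp h]
      exact Ideal.mul_mem_right _ _ (Ideal.pow_mem_pow hûm k)
  rw [hct2, hcs2, hc'2, hPh, Polynomial.eval₂_map, hcomp, Polynomial.eval₂_eq_eval_map]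
  have hev : (algebraMap R' (AdicCompletion (maximalIdeal R') R')) (Polynomial.eval w₁' (Polynomial.map φ P)) =
      Polynomial.eval ((algebraMap R' (AdicCompletion (maximalIdeal R') R')) w₁') (Polynomial.map ((algebraMap R' (AdicCompletion (maximalIdeal R') R')).comp φ) P) := by
    rw [Polynomial.eval_map, Polynomial.hom_eval₂, ← Polynomial.eval_map]
  rw [hev]
  obtain ⟨q', hq'⟩ := Polynomial.sub_dvd_eval_sub th ((algebraMap R' (AdicCompletion (maximalIdeal R') R')) w₁') (Polynomial.map ((algebraMap R' (AdicCompletion (maximalIdeal R') R')).comp φ) P)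
  rw [hq']
  exact Ideal.mul_mem_right _ _ hth'

end NonRationalCompletedStep

end Literature.AlgebraicGeometry.Resolution

end
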